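import Summits.QuantumFields.YangMills.Theorems.UnitScaleTiltProp7TrueLinIterDefect
import Summits.QuantumFields.YangMills.Theorems.UnitScaleTiltProp7TrueLinSourcedDefectL1Rows
import HarnessLib

/-!
# Route `UnitScaleTilt`, crux K1 «MinimiserStabilityRegPr» (stmt-QuantumFields-19200), EX face — one-form VALUE book, letter (COL) of ★p1 g26 CHAIR WORD №5 (b),
# generic brick — THE `ℓ¹`-COLUMN (ENTRYWISE) TWIN OF DEFECT: THE REDUCED TRUE-LINEARISED ITERATE `G_k` IS AN `ℓ¹ → ℓ¹` CONTRACTION BY `L^{1−d}` PER LEVEL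
# UP TO A SUMMABLE CURVATURE DEFECT: `Σ_c ‖G_k(c)‖ ≤ (L^{1−d})^k·exp((κ₁∕ρ₁)·Σ_{j<k} a_j)·Σ_b ‖Y(b)‖`, `ρ₁ = L^{1−d}`, `κ₁ = 159(d+2)L·2d`

Cell `ym3-torus` (HUMAN RULING D-0037; rung R3 = SU(2) YM₃ on T³ — NOT d = 4, NOT infinite volume, NOT a mass gap, NOT Clay).  Width seat `ym3-torus-px13` (gen 15; frames ∕
intertwiner lineage), sitting on ★p1 g26 CHAIR WORD №5 (b) «(COL) = OPEN ANALYTIC LETTER of the one-form book; LOCATE-WANTED → px13 lineage».  THEOREMS ONLY (0 `def`, 0 `sorry`,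
default heartbeats); `--supports stmt-QuantumFields-19200 --as helper`; count-neutral.

THE POINT.  (COL) — `Σ_c ‖(QTwS U₀ (δ_b ⊗ X))(c)‖ ≤ C_Q·ℓ⁻²·‖X‖`, displayed by px17 g10's ✓`Prop7QkAdjointSupRowOfRegPr.norm_toL2_symm_adjoint_Qk_apply_le_of_col` as `hcol` — is the
COLUMN-`ℓ¹` (`ℓ¹ → ℓ¹` operator) norm of the averaging operator of record; px17's LOCATE called it «the `ℓ¹ → ℓ^∞` twin of ✓`Prop7TrueLinIterDefect`».  This file IS that twin, and
it is a RE-SUMMATION of landed per-level letters, no new analysis: ✓`Prop7TrueLinReducedStep` writes one step of the reduced true linearisation as `G_{j+1} = LINE_j(G_j) + D_j`;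
routeR-w6 g3's ✓`Prop7TrueLinSourcedDefectL1Rows` (route-R row (n3) file 1a; located for this pen by px17 g10's read 2026-08-30 08:07Z) has the two ONE-LEVEL `ℓ¹` rows —
`sum_norm_line_le`: `Σ_c ‖LINE_VZ(c)‖ ≤ L^{1−d}·Σ_b ‖Z(b)‖` (✓`norm_line_le` + the `L`-to-one reparametrisation ✓`sum_coarse_offsets_shifts`; sharp on spikes: the flat tent count) and
`sum_norm_defect_le`: `Σ_c ‖D_j(c)‖ ≤ 159·a_j·(d+2)L·2d·Σ_b ‖Z(b)‖` (✓`norm_defect_le_nbhd` + multiplicity ✓`sum_nbhd_le`) — IMPORTED here, not restated.  Hence per level `g_{j+1} ≤ (ρ₁ + κ₁a_j)·g_j` for `g_j := Σ_c‖G_j(c)‖` with `ρ₁ := (L^d)⁻¹·L`, `κ₁ := 159(d+2)L·2d`, and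
✓`Prop7TrueLinIterDefect.recursion_bound` (the same real-sequence lemma DEFECT uses, no `2^k`) gives §2 (routeR-w6's ✓`Prop7TrueLinSourcedDefectL1.sum_norm_sourcedReduced_le` is the
SOURCED edition of the second conjunct; the first conjunct — the `ℓ¹` comparison with the pure `LINE`-iterate `S_k`, DEFECT's shape — is the new row): `Σ_c‖G_k(c)‖ ≤ ρ₁^k·exp((κ₁∕ρ₁)Σ_{j<k}a_j)·Σ_b‖Y(b)‖` together with the
`ℓ¹` comparison against the pure `LINE`-iterate `S_k`.  WHY THIS IS (COL) (next files): at the d = 3 carrier `ρ₁^k = ℓ^{1−d} = ℓ⁻²` EXACTLY — no `ℓ^{3∕2}` loss, unlike the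
`ℓ²` route (`ρ^k = ℓ^{−1∕2}`) — and with the GEOMETRIC loop sizes of a printed-regular tower `a_j = stokes·2ε₀·(Lʲ∕ℓ)²` (✓`tower_plaq_lt`, [Balaban1985Averaging] Prop. 2 (53):
level-wise curvature decay, which is exactly the «which level-wise curvature row does `RegPr` put on Ū⁽ʲ⁾W» question of px13 g14's LOCATE, answered: the smooth scaling)
`Σ_{j<k} a_j ≤ ((d+2)L)²ε₀∕16` K-UNIFORMLY, so `C_Q = exp(κ₁((d+2)L)²ε₀∕(16ρ₁)) ≤ 1 + 10⁻⁴` in the EX window: (COL) SHARP, K-FREE, no `log ℓ`.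

WHAT IS PROVED (ns `…Theorems.Prop7TrueLinIterColumn`; one-step operator, `LINE_V`, `P_V`, `CM_V` written out as in DEFECT, VERBATIM).
* §1 `sum_norm_add_le` (finite `ℓ¹` triangle); the one-level rows are ✓`Prop7TrueLinSourcedDefectL1Rows`'s (imported).
* §2 ★★ `sum_norm_reduced_sub_lineIter_le` — DEFECT's ✓`sqrt_sum_normSq_reduced_sub_lineIter_le` with `√Σ‖·‖²` replaced by `Σ‖·‖`, `ρ` by `ρ₁ = (L^d)⁻¹L`, `κ` by `κ₁ = 159(d+2)L·2d`:
  hypotheses VERBATIM (`G`, `S`, `hG0 hS0 hGs hSs`, `a`, `ha0 hk hα ha24 haN`); `ρ₁·Σ_c‖G k c − S k c‖ ≤ ρ₁^k·κ₁·(Σ_{j<k}a j)·exp((κ₁∕ρ₁)Σ_{j<k}a j)·Σ_b‖Y b‖` and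
  `Σ_c‖G k c‖ ≤ ρ₁^k·exp((κ₁∕ρ₁)Σ_{j<k}a j)·Σ_b‖Y b‖`.
HONEST SCOPE.  `ℓ¹` bookkeeping over landed one-step letters; the identification of `G_{K−n}` with `QTwS U₀` (px13 g11 ✓`QTwS_apply_eq_frameReduced_bondShift`), the discharge of the
`a j` from `RegPr`, the 𝔰𝔲(2) ∕ scalar sectors and the (COL) letter itself are the sequel files; nothing of (P-Q†)'s slot, the nine EX rows, `hT`, EX or the crux is proved here.

References: T. Bałaban, CMP **95** (1984) 17–40 [Balaban1984PropagatorsI] ((1.11), (1.18)–(1.20) pp.19–20); CMP **98** (1985) 17–51 [Balaban1985Averaging] (Prop. 2 (53) p.26,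
Prop. 3 (124)–(126) p.36); CMP **99** (1985) 389–434 [Balaban1985BackgroundPropagators] ((3.13)–(3.15) p.393).
-/

set_option autoImplicit false

noncomputable section

open scoped BigOperators Matrix.Norms.L2Operator

namespace Summit.QuantumFields.YangMills.Theorems.Prop7TrueLinIterColumn

open Literature.MathematicalPhysics.QuantumFieldTheory.Balaban1983to89
open Finset T4Continuum BlockAveraging AveragingRT ExpMeanLog BlockAveragingEMLLinearised BlockAveragingEMLLinearisedBackground BlockAveragingEMLProp2
open Summit.QuantumFields.YangMills.Theorems.Prop7TrueLinLineBound (line_sub)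
open Summit.QuantumFields.YangMills.Theorems.Prop7TrueLinSourcedDefectL1Rows (sum_norm_line_le sum_norm_defect_le)
open Summit.QuantumFields.YangMills.Theorems.Prop7TrueLinIterDefect (recursion_bound)

variable {P : Params} {n : Type*} [Fintype n] [DecidableEq n] [Nonempty n] {j : ℕ}

/-! ## §1 The one-step `ℓ¹`-column rows are routeR-w6 g3's ✓`Prop7TrueLinSourcedDefectL1Rows.sum_norm_line_le` ∕ `sum_norm_defect_le` (imported, not restated); finite `ℓ¹` triangle -/

/-- Finite triangle inequality in `ℓ¹`: `Σ‖f i + g i‖ ≤ Σ‖f i‖ + Σ‖g i‖`. [folklore] -/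
theorem sum_norm_add_le {ι E : Type*} [Fintype ι] [SeminormedAddCommGroup E] (f g : ι → E) :
    ∑ i, ‖f i + g i‖ ≤ ∑ i, ‖f i‖ + ∑ i, ‖g i‖ := by
  rw [← Finset.sum_add_distrib]
  exact Finset.sum_le_sum fun i _ => norm_add_le _ _

/-! ## §2 ★★ The `k`-fold `ℓ¹`-column rows of the reduced iterate -/

/-- ★★ **`G_k` IN THE COLUMN-`ℓ¹` NORM, k-UNIFORMLY, AND VERSUS THE PURE `LINE`-ITERATE.**  Tower `Ū₀^{(j)} = Averaging.iter (blockAvg ℰp) j U₀` in the standing range `k ≤ m + K`;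
`G` the reduced recursion family at the covariant stair mean (`hG0`, `hGs` — DEFECT's letters VERBATIM), `S` the pure recursion `S 0 = Y`, `S (j+1) c = LINE_{Ū₀^{(j)}}(S j)(c)`
(`hS0`, `hSs`); per-level loop-variable sizes `dist1(W^{(j)}_i(c)) ≤ a j ≤ 1∕24`, `a j < δ_N`, `0 ≤ a j` (`j < k`).  Then with `ρ₁ = (L^d)⁻¹·L` (`= L^{1−d}`) and
`κ₁ = 159·(d+2)L·(2d)`:  `ρ₁·Σ_c‖G k c − S k c‖ ≤ ρ₁^k·κ₁·(Σ_{j<k} a j)·exp((κ₁∕ρ₁)Σ_{j<k} a j)·Σ_b‖Y b‖` and `Σ_c‖G k c‖ ≤ ρ₁^k·exp((κ₁∕ρ₁)Σ_{j<k} a j)·Σ_b‖Y b‖`.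
Per level `g_{j+1} ≤ (ρ₁ + κ₁a_j)g_j`, `δ_{j+1} ≤ ρ₁δ_j + κ₁a_jg_j` by ✓`sum_norm_line_le`∕✓`sum_norm_defect_le` and ✓`line_sub`; then ✓`recursion_bound`.
[cite: Balaban1984PropagatorsI, (1.18)-(1.20) pp.19-20; Balaban1985Averaging, Prop. 3 (124)-(126) p.36] -/
theorem sum_norm_reduced_sub_lineIter_le (U₀ : GaugeField P 0 (Matrix.specialUnitaryGroup n ℂ)) (Y : PBond P 0 → Matrix n n ℂ)
    (G S : (k : ℕ) → PBond P k → Matrix n n ℂ) (hG0 : ∀ b, G 0 b = Y b) (hS0 : ∀ b, S 0 b = Y b)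
    (hGs : ∀ (k : ℕ) (c : PBond P (k + 1)), G (k + 1) c
      = (fderiv ℂ (eml : (Idx P → Matrix n n ℂ) → Matrix n n ℂ)
            (fun i => ((loopHol (Averaging.iter (fun i => blockAvg (P := P) (j := i) (expMeanLogSU (n := n))) k U₀) c i :
              Matrix.specialUnitaryGroup n ℂ) : Matrix n n ℂ))
            (fun i => covWalkSum (Averaging.iter (fun i => blockAvg (P := P) (j := i) (expMeanLogSU (n := n))) k U₀) (G k)
                (walk (emb c.src) (loopWord P.L c.dir (off i.1) i.2.1 i.2.2))
              * ((loopHol (Averaging.iter (fun i => blockAvg (P := P) (j := i) (expMeanLogSU (n := n))) k U₀) c i :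
                Matrix.specialUnitaryGroup n ℂ) : Matrix n n ℂ))
            * star ((corr (expMeanLogSU (n := n)) (Averaging.iter (fun i => blockAvg (P := P) (j := i) (expMeanLogSU (n := n))) k U₀) c :
                Matrix.specialUnitaryGroup n ℂ) : Matrix n n ℂ)
          + ((corr (expMeanLogSU (n := n)) (Averaging.iter (fun i => blockAvg (P := P) (j := i) (expMeanLogSU (n := n))) k U₀) c :
                Matrix.specialUnitaryGroup n ℂ) : Matrix n n ℂ)
            * covWalkSum (Averaging.iter (fun i => blockAvg (P := P) (j := i) (expMeanLogSU (n := n))) k U₀) (G k)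
                (walk (emb c.src) (List.replicate P.L (c.dir, true)))
            * star ((corr (expMeanLogSU (n := n)) (Averaging.iter (fun i => blockAvg (P := P) (j := i) (expMeanLogSU (n := n))) k U₀) c :
                Matrix.specialUnitaryGroup n ℂ) : Matrix n n ℂ))
        - ((((Fintype.card (Idx P) : ℂ))⁻¹ • ∑ i : Idx P,
              covWalkSum (Averaging.iter (fun i => blockAvg (P := P) (j := i) (expMeanLogSU (n := n))) k U₀) (G k) (walk (emb c.src) (stairWord i.2.1 (off i.1))))
            - ((Averaging.iter (fun i => blockAvg (P := P) (j := i) (expMeanLogSU (n := n))) (k + 1) U₀ c : Matrix.specialUnitaryGroup n ℂ) :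
                Matrix n n ℂ)
              * (((Fintype.card (Idx P) : ℂ))⁻¹ • ∑ i : Idx P,
                  covWalkSum (Averaging.iter (fun i => blockAvg (P := P) (j := i) (expMeanLogSU (n := n))) k U₀) (G k) (walk (emb c.tgt) (stairWord i.2.1 (off i.1))))
              * star ((Averaging.iter (fun i => blockAvg (P := P) (j := i) (expMeanLogSU (n := n))) (k + 1) U₀ c :
                Matrix.specialUnitaryGroup n ℂ) : Matrix n n ℂ)))
    (hSs : ∀ (k : ℕ) (c : PBond P (k + 1)), S (k + 1) c
      = ((Fintype.card (Idx P) : ℂ))⁻¹ • ∑ i : Idx P,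
          ((holAt (Averaging.iter (fun i => blockAvg (P := P) (j := i) (expMeanLogSU (n := n))) k U₀) (walk (emb c.src) (stairWord i.2.1 (off i.1))) :
              Matrix.specialUnitaryGroup n ℂ) : Matrix n n ℂ) *
            covWalkSum (Averaging.iter (fun i => blockAvg (P := P) (j := i) (expMeanLogSU (n := n))) k U₀) (S k)
              (walk (walkEnd (emb c.src) (stairWord i.2.1 (off i.1))) (List.replicate P.L (c.dir, true))) *
          star ((holAt (Averaging.iter (fun i => blockAvg (P := P) (j := i) (expMeanLogSU (n := n))) k U₀) (walk (emb c.src) (stairWord i.2.1 (off i.1))) :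
              Matrix.specialUnitaryGroup n ℂ) : Matrix n n ℂ))
    (a : ℕ → ℝ) (ha0 : ∀ j, 0 ≤ a j) {k : ℕ} (hk : k ≤ P.m + P.K)
    (hα : ∀ j < k, ∀ (c : PBond P (j + 1)) (i : Idx P),
        dist1 (loopHol (Averaging.iter (fun i => blockAvg (P := P) (j := i) (expMeanLogSU (n := n))) j U₀) c i) ≤ a j)
    (ha24 : ∀ j < k, a j ≤ 1 / 24) (haN : ∀ j < k, a j < deltaSU n) :
    ((P.L : ℝ) ^ P.d)⁻¹ * (P.L : ℝ) * ∑ c : PBond P k, ‖G k c - S k c‖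
        ≤ (((P.L : ℝ) ^ P.d)⁻¹ * (P.L : ℝ)) ^ k * (159 * (((P.d + 2) * P.L : ℕ) : ℝ) * (2 * P.d))
          * (∑ j ∈ Finset.range k, a j) * Real.exp ((159 * (((P.d + 2) * P.L : ℕ) : ℝ) * (2 * P.d))
              / (((P.L : ℝ) ^ P.d)⁻¹ * (P.L : ℝ)) * ∑ j ∈ Finset.range k, a j) * ∑ b : PBond P 0, ‖Y b‖
      ∧ ∑ c : PBond P k, ‖G k c‖
        ≤ (((P.L : ℝ) ^ P.d)⁻¹ * (P.L : ℝ)) ^ k * Real.exp ((159 * (((P.d + 2) * P.L : ℕ) : ℝ) * (2 * P.d))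
              / (((P.L : ℝ) ^ P.d)⁻¹ * (P.L : ℝ)) * ∑ j ∈ Finset.range k, a j) * ∑ b : PBond P 0, ‖Y b‖ := by
  have hLpos : (0 : ℝ) < (P.L : ℝ) := by exact_mod_cast P.L_pos
  -- letters
  set ρ : ℝ := ((P.L : ℝ) ^ P.d)⁻¹ * (P.L : ℝ) with hρ
  set κ : ℝ := 159 * (((P.d + 2) * P.L : ℕ) : ℝ) * (2 * P.d) with hκ
  have hρpos : 0 < ρ := by positivity
  have hκ0 : 0 ≤ κ := by positivity
  -- the real sequences
  set g : ℕ → ℝ := fun j => ∑ c : PBond P j, ‖G j c‖ with hg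
  set δ : ℕ → ℝ := fun j => ∑ c : PBond P j, ‖G j c - S j c‖ with hδ
  have hg_nn : ∀ j, 0 ≤ g j := fun j => Finset.sum_nonneg fun c _ => norm_nonneg _
  have hδ0 : δ 0 = 0 := by
    simp only [hδ, hG0, hS0, sub_self, norm_zero]
    simp
  have hg0 : g 0 = ∑ b : PBond P 0, ‖Y b‖ := by simp only [hg, hG0]
  -- per-level rows
  have hrows : ∀ j < k, g (j + 1) ≤ (ρ + κ * a j) * g j ∧ δ (j + 1) ≤ ρ * δ j + κ * a j * g j := by
    intro j hj
    have hj1 : j + 1 ≤ P.m + P.K := by omega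
    set V := Averaging.iter (fun i => blockAvg (P := P) (j := i) (expMeanLogSU (n := n))) j U₀ with hV
    -- the three level-`j` fields as functions of the coarse bond: defect `D`, `LINE(G j)`, `LINE(G j − S j)`
    set D : PBond P (j + 1) → Matrix n n ℂ := fun c =>
      (fderiv ℂ (eml : (Idx P → Matrix n n ℂ) → Matrix n n ℂ) (fun i => ((loopHol V c i : Matrix.specialUnitaryGroup n ℂ) : Matrix n n ℂ))
          (fun i => covWalkSum V (G j) (walk (emb c.src) (loopWord P.L c.dir (off i.1) i.2.1 i.2.2))
            * ((loopHol V c i : Matrix.specialUnitaryGroup n ℂ) : Matrix n n ℂ))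
          * star ((corr (expMeanLogSU (n := n)) V c : Matrix.specialUnitaryGroup n ℂ) : Matrix n n ℂ)
        + ((corr (expMeanLogSU (n := n)) V c : Matrix.specialUnitaryGroup n ℂ) : Matrix n n ℂ)
          * covWalkSum V (G j) (walk (emb c.src) (List.replicate P.L (c.dir, true)))
          * star ((corr (expMeanLogSU (n := n)) V c : Matrix.specialUnitaryGroup n ℂ) : Matrix n n ℂ))
      - ((((Fintype.card (Idx P) : ℂ))⁻¹ • ∑ i : Idx P, covWalkSum V (G j) (walk (emb c.src) (stairWord i.2.1 (off i.1))))
          - ((avgFun (expMeanLogSU (n := n)) V c : Matrix.specialUnitaryGroup n ℂ) : Matrix n n ℂ)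
              * (((Fintype.card (Idx P) : ℂ))⁻¹ • ∑ i : Idx P, covWalkSum V (G j) (walk (emb c.tgt) (stairWord i.2.1 (off i.1))))
              * star ((avgFun (expMeanLogSU (n := n)) V c : Matrix.specialUnitaryGroup n ℂ) : Matrix n n ℂ))
      - ((Fintype.card (Idx P) : ℂ))⁻¹ • ∑ i : Idx P,
          ((holAt V (walk (emb c.src) (stairWord i.2.1 (off i.1))) : Matrix.specialUnitaryGroup n ℂ) : Matrix n n ℂ) *
            covWalkSum V (G j) (walk (walkEnd (emb c.src) (stairWord i.2.1 (off i.1))) (List.replicate P.L (c.dir, true))) *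
          star ((holAt V (walk (emb c.src) (stairWord i.2.1 (off i.1))) : Matrix.specialUnitaryGroup n ℂ) : Matrix n n ℂ) with hD
    set LG : PBond P (j + 1) → Matrix n n ℂ := fun c => ((Fintype.card (Idx P) : ℂ))⁻¹ • ∑ i : Idx P,
          ((holAt V (walk (emb c.src) (stairWord i.2.1 (off i.1))) : Matrix.specialUnitaryGroup n ℂ) : Matrix n n ℂ) *
            covWalkSum V (G j) (walk (walkEnd (emb c.src) (stairWord i.2.1 (off i.1))) (List.replicate P.L (c.dir, true))) *
          star ((holAt V (walk (emb c.src) (stairWord i.2.1 (off i.1))) : Matrix.specialUnitaryGroup n ℂ) : Matrix n n ℂ) with hLG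
    set LΔ : PBond P (j + 1) → Matrix n n ℂ := fun c => ((Fintype.card (Idx P) : ℂ))⁻¹ • ∑ i : Idx P,
          ((holAt V (walk (emb c.src) (stairWord i.2.1 (off i.1))) : Matrix.specialUnitaryGroup n ℂ) : Matrix n n ℂ) *
            covWalkSum V (G j - S j) (walk (walkEnd (emb c.src) (stairWord i.2.1 (off i.1))) (List.replicate P.L (c.dir, true))) *
          star ((holAt V (walk (emb c.src) (stairWord i.2.1 (off i.1))) : Matrix.specialUnitaryGroup n ℂ) : Matrix n n ℂ) with hLΔ
    -- the two decompositions `G (j+1) = D + LINE(G j)`, `G (j+1) − S (j+1) = D + LINE(G j − S j)`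
    have hiter : Averaging.iter (fun i => blockAvg (P := P) (j := i) (expMeanLogSU (n := n))) (j + 1) U₀ = avgFun (expMeanLogSU (n := n)) V := rfl
    have hdecG : ∀ c, G (j + 1) c = D c + LG c := by
      intro c
      rw [hGs, hiter]
      simp only [hD, hLG]
      abel
    have hdecΔ : ∀ c, G (j + 1) c - S (j + 1) c = D c + LΔ c := by
      intro c
      rw [hdecG, hSs, hLΔ, hLG, hD]
      simp only [line_sub V (G j) (S j) c]
      abel
    -- the `ℓ¹` rows of the pieces
    have hDrow : ∑ c, ‖D c‖ ≤ κ * a j * g j := by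
      have h := sum_norm_defect_le hj1 V (G j) (ha0 j) (hα j hj) (ha24 j hj) (haN j hj)
      have h' : ∑ c, ‖D c‖ ≤ 159 * a j * (((P.d + 2) * P.L : ℕ) : ℝ) * (2 * P.d) * ∑ b, ‖G j b‖ := by
        simpa only [hD] using h
      calc ∑ c, ‖D c‖ ≤ 159 * a j * (((P.d + 2) * P.L : ℕ) : ℝ) * (2 * P.d) * ∑ b, ‖G j b‖ := h'
        _ = κ * a j * g j := by rw [hκ, hg]; ring
    have hLGrow : ∑ c, ‖LG c‖ ≤ ρ * g j := by
      have h := sum_norm_line_le hj1 V (G j)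
      simpa only [hLG, hρ, hg] using h
    have hLΔrow : ∑ c, ‖LΔ c‖ ≤ ρ * δ j := by
      have h := sum_norm_line_le hj1 V (G j - S j)
      simpa only [hLΔ, hρ, hδ, Pi.sub_apply] using h
    constructor
    · calc g (j + 1) = ∑ c, ‖D c + LG c‖ := by simp only [hg, hdecG]
        _ ≤ ∑ c, ‖D c‖ + ∑ c, ‖LG c‖ := sum_norm_add_le D LG
        _ ≤ κ * a j * g j + ρ * g j := add_le_add hDrow hLGrow
        _ = (ρ + κ * a j) * g j := by ring
    · calc δ (j + 1) = ∑ c, ‖D c + LΔ c‖ := by simp only [hδ, hdecΔ]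
        _ ≤ ∑ c, ‖D c‖ + ∑ c, ‖LΔ c‖ := sum_norm_add_le D LΔ
        _ ≤ κ * a j * g j + ρ * δ j := add_le_add hDrow hLΔrow
        _ = ρ * δ j + κ * a j * g j := by ring
  -- the recursion bound
  have hmain := recursion_bound hρpos hκ0 a g δ ha0 hg_nn hδ0 k (fun j hj => (hrows j hj).1) (fun j hj => (hrows j hj).2)
  rw [hg0] at hmain
  exact ⟨hmain.2, hmain.1⟩

end Summit.QuantumFields.YangMills.Theorems.Prop7TrueLinIterColumn

end
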